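import Literature.AlgebraicGeometry.ShimuraVarieties.UnitaryCurveConjugateSliceDescends          -- ★ p850264 (mine): §1 `lift_comp_sliceComplexOfSlice_fst` (complexified slice reads `f`); re-exports ★ p849947 ∕ p849897 ∕ E5
import Literature.AlgebraicGeometry.ShimuraVarieties.UnitaryCurveHeckeOrbitExtContinuous          -- ★ p850424 (LA4-p02): (β1) `RecordSystemGS.map_eq_of_heckeOrbit_of_continuous_mk_pts`
import Literature.AlgebraicGeometry.Motives.GaloisThickening                                        -- ★ `thickeningLift` (the sheet sections `ℓ_e`)
import HarnessLib

/-!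
# The point law on the CONJUGATE SHEET of the unitary Shimura curve from the forward reciprocity law and a piecewise-continuous target map
# ([Milne 2005] Lemma 13.5 + Thm. 13.6 p. 118 with the second slice replaced by a CONTINUOUS point map; [GortzWedhorn2020] §(4.8)–(4.9), (14.20): the sheets)

Topic `AlgebraicGeometry/ShimuraVarieties`, namespace `…ShimuraVarieties.UnitaryCanonicalModel` (the objects of ★ `UnitaryShimuraCurveRecord` ∕ ★ E5
`UnitaryCurveSiegelDescent`).  THEOREMS ONLY (no definition, no instance, no notation, no named fact, no `sorry`).  Cell `hodgecm-mathlib` (D-0151),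
P6 «MOD programme», crux hLiu418 (stmt-HodgeConjecture-24832, `--supports`, count-neutral), line «L4», closer `Lines/F0_P6a_StubESHEET.lean`, socket
`hole_SHEET_complex : OrganSHEETComplex` (LA7-p01 (g3) LEG-E frame v5), ROAD B′∕(β) (LA4-plan (g2) 07:43:53Z, 08:01:03Z), DEAL #37 «`f₂` + the global point
law on the twisted sheet» (LA4-p01 (g3) chart currency) — THIS FILE IS ITS GENERIC ENGINE (LA4-p03 (g3), the (β)-twin of ★ p849897 §1 → ★ p849947 → ★ p850264).
HONEST LABEL: HC_CM is proved only modulo the 2 remaining named inputs (hLiu418 24832, h413 24833) until rung 0 closes; this file is generic and count-neutral.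

THE MATHEMATICS.  Record curve `S` over the CM field `L` along `τ`, small level `K`, a `ℚ`-scheme `M` (separated where said), ONE complex slice
`ψ : (M_K)_τ → M_ℂ` reading `f : Sh_K(ℂ) → M(ℂ)` (E5 currency), `σL ∈ Aut(ℂ∕τL)`, a special point `x₀ = [τw]`, and a SECOND point map `f₂ : Sh_K(ℂ) → M(ℂ)`
which is NOT assumed to come from a morphism.  ★ p849897 §1 computed, on the Hecke orbit of `x₀`, the conjugate `T′ = (1 × Spec σL) ≫ ψ ≫ (1 × Spec σL|_ℚ⁻¹)`
at `P = pts⁻¹[x₀, aK]`: `T′(P) = σL|_ℚ • f[x₀, d′a]` (record reciprocity at `σL⁻¹`, twist `d′`), `= f₂[x₀, a]` by the twisted law — there read as `ψ₂(P)` for a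
second slice `ψ₂`; HERE read as the point `(f₂[x₀, a], 1)` of `M_ℂ` (§1, no `ψ₂`).  If `f₂` is continuous in the cone variable on each adelic piece
(★ p850443 ∕ `AuxChartGS.continuous_mk_left_of_pts_shadow` shape), (β1) ★ p850424 (Milne Lemma 13.5: the orbit is dense; `T′` is a morphism, so its point
map is continuous; `M_ℂ(ℂ)` is Hausdorff) upgrades the orbit identity to EVERY point: `T′(P, 1) = (f₂ (pts P), 1)` (§2).  §3 reads this on the SHEETS of
`M_K ⊗_L E` for a slice field `E ⊇ L` with complex place `τE ∣ τ`, an `E`-slice `ε : M_K ⊗_L E → M ⊗_ℚ E` inducing `f` (E5 currency `hε`), `γ ∈ Gal(E∕L)` and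
a lift `σL` (`σL ∘ τE = τE ∘ γ`): the section `ℓ_{τE∘γ} Q = (Q, Spec(τE∘γ))` of the thickening satisfies `Spec σL⁻¹ ≫ ℓ_{τE∘γ} Q = ℓ_{τE} (σL⁻¹ • Q)`
([GortzWedhorn2020] (14.20): `Aut(ℂ)` permutes the sheets), a `τE`-point over `σL⁻¹ • Q`, so `hε` reads `ℓ_{τE∘γ} Q ≫ ε ≫ pr₁ = Spec σL ≫ f(pts(σL⁻¹ • Q))`,
which is ALSO the first projection of `T′(Q, 1)` for the complexified slice `ψ = ε ⊗_{τE} ℂ` (★ p850264 §1) — whence THE SHEET HEAD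
**`ℓ_{τE∘γ} Q ≫ ε ≫ pr₁ = f₂ (pts Q)` for EVERY complex point `Q` of `M_K`** (no descent, no second slice): the «classifying point of the fibre on the
conjugate sheet» input of `OrganSHEETComplex` (DEAL #34 ADM ⇒ ISO, DEAL #32′ marked Serre tensor) once `f₂ :=` the twisted chart formula (DEAL #37).
* §0 `thickeningLift_left_comp_eq_specAut_comp` — `ℓ_{e∘γ} Q = Spec σ ≫ ℓ_e (σ⁻¹ • Q)` on underlying morphisms (`σ ∘ e = e ∘ γ`);
* §1 **`RecordSystemGS.map_conj_baseChangeEquiv_eq_of_twisted_recip`** — `T′(pts⁻¹[x₀,a], 1) = (f₂[x₀,a], 1)` from the twisted law (★ p849897 §1 without `ψ₂`);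
* §2 **`RecordSystemGS.map_conj_baseChangeEquiv_eq_of_forward_recip_of_continuous`** — `T′(P, 1) = (f₂ (pts P), 1)` for every `P` (forward law + (β1));
* §3 **`RecordSystemGS.thickeningLift_comp_slice_fst_eq_of_forward_recip_of_continuous`** — THE SHEET HEAD over the slice field.

## References
* [Milne2005ShimuraVarieties] J. S. Milne, *Introduction to Shimura varieties* (2005; rev. 2017), §13: Prop. 13.1 p. 117, Lemma 13.5 and Thm. 13.6 p. 118 (L29–41); Def. 12.8 (62) p. 114.
* [GortzWedhorn2020] U. Görtz, T. Wedhorn, *Algebraic Geometry I* (2nd ed. 2020), §(4.8)–(4.9), Prop. 4.16, §(14.20).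
* [Shimura1998] G. Shimura, *Abelian Varieties with Complex Multiplication and Modular Functions* (1998), §18.6 (pp. 124–128).
* [RapoportSmithlingZhang2020Diagonal] M. Rapoport, B. Smithling, W. Zhang (2020), §3.2 p. 11 (the sheets of `M ⊗_F Fᵢ` and their twists).
-/

set_option autoImplicit false

noncomputable section

open Function MulAction Topology NumberField IsDedekindDomain CategoryTheory CategoryTheory.Limits Matrix
  AlgebraicGeometry Cardinal
open scoped Matrix ComplexOrder
open Literature.AlgebraicGeometry.Motives Literature.NumberTheory.Automorphic Literature.NumberTheory.Automorphic.UnitaryGroup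
open Literature.NumberTheory.Automorphic.Liu2021.AppendixC (C5.OpenCompactSubgroup C5.SmallLevel)
open Literature.AlgebraicGeometry.Motives.AbelianVariety (bcSpec bcFunctor specAut)

namespace Literature.AlgebraicGeometry.ShimuraVarieties.UnitaryCanonicalModel

variable {L : Type} [Field L] [NumberField L] [IsCMField L] {Jstar : Matrix (Fin 2) (Fin 2) L} {τ : L →+* ℂ}
  {K₀ : C5.OpenCompactSubgroup ↥(finAdelic (↥(maximalRealSubfield L)) L (IsCMField.complexConj L) 2 Jstar)}

/-! ### §0 The sheets under `Aut(ℂ∕τL)`: `ℓ_{e∘γ} Q = Spec σ ≫ ℓ_e (σ⁻¹ • Q)` -/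

omit [IsCMField L] in
/-- `specAut` only sees the underlying ring map: an automorphism over `τL` and its restriction of scalars to `ℚ` have the same `Spec`. [folklore] -/
private theorem specAut_restrictScalars_rat' (σL : letI : Algebra L ℂ := τ.toAlgebra; ℂ ≃ₐ[L] ℂ) :
    letI : Algebra L ℂ := τ.toAlgebra
    specAut ℂ σL = specAut ℂ (σL.restrictScalars ℚ) := by
  letI : Algebra L ℂ := τ.toAlgebra
  have hh : (σL : ℂ →+* ℂ) = ((σL.restrictScalars ℚ : ℂ ≃ₐ[ℚ] ℂ) : ℂ →+* ℂ) := RingHom.ext fun _ => rfl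
  change Spec.map (CommRingCat.ofHom (σL : ℂ →+* ℂ)) = Spec.map (CommRingCat.ofHom ((σL.restrictScalars ℚ : ℂ ≃ₐ[ℚ] ℂ) : ℂ →+* ℂ))
  rw [hh]

omit [NumberField L] [IsCMField L] in
/-- **`Aut(ℂ∕τL)` PERMUTES THE SHEETS**: for an `L`-scheme `X`, a field `E ⊇ L` with a sheet `e : E →ₐ[L] ℂ`, `γ ∈ Aut_L(E)` and `σ ∈ Aut(ℂ∕τL)` with
`σ ∘ e = e ∘ γ`, the section `ℓ_{e∘γ} Q = (Q, Spec(e∘γ))` of `X ⊗_L E` at a complex point `Q` of `X` is `Spec σ ≫ ℓ_e (σ⁻¹ • Q)` (the tree's LEFT action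
`σ⁻¹ • Q = Spec σ⁻¹ ≫ Q`; on the second factor `Spec σ⁻¹ ≫ Spec(e∘γ) = Spec(σ⁻¹ ∘ e ∘ γ) = Spec e`). [cite: GortzWedhorn2020, §(4.8)–(4.9) and §(14.20)]
[cite: Milne2005ShimuraVarieties, Prop. 13.1 p. 117] -/
theorem thickeningLift_left_comp_eq_specAut_comp (X : SchemeOver L) {E : Type} [Field E] [Algebra L E]
    (e : letI : Algebra L ℂ := τ.toAlgebra; E →ₐ[L] ℂ) (γ : E ≃ₐ[L] E) (σ : letI : Algebra L ℂ := τ.toAlgebra; ℂ ≃ₐ[L] ℂ)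
    (hσγ : letI : Algebra L ℂ := τ.toAlgebra; ∀ x : E, σ (e x) = e (γ x)) (Q : letI : Algebra L ℂ := τ.toAlgebra; ComplexPoints X) :
    letI : Algebra L ℂ := τ.toAlgebra
    (thickeningLift (e.comp (γ : E →ₐ[L] E)) X Q).toSpecHom = specAut ℂ σ ≫ (thickeningLift e X (σ⁻¹ • Q)).toSpecHom := by
  letI : Algebra L ℂ := τ.toAlgebra
  apply pullback.hom_ext
  · erw [thickeningLift_left_comp_fst, Category.assoc, thickeningLift_left_comp_fst]
    change Q.toSpecHom = specAut ℂ σ ≫ (σ⁻¹ • Q).toSpecHom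
    rw [toSpecHom_smul, ← Category.assoc, AbelianVariety.specAut_comp_specAut_symm, Category.id_comp]
  · erw [thickeningLift_left_comp_snd, Category.assoc, thickeningLift_left_comp_snd]
    change Spec.map (CommRingCat.ofHom ((e.comp (γ : E →ₐ[L] E) : E →ₐ[L] ℂ) : E →+* ℂ)) =
      Spec.map (CommRingCat.ofHom (σ : ℂ →+* ℂ)) ≫ Spec.map (CommRingCat.ofHom (e : E →+* ℂ))
    rw [← Spec.map_comp, ← CommRingCat.ofHom_comp]
    congr 2
    ext x
    change e (γ x) = σ (e x)
    rw [hσγ]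

/-! ### §1 The conjugate slice on the Hecke orbit of a special point, against an ARBITRARY second point map -/

section OneSlice

variable (S : RecordSystemGS L Jstar τ K₀) (K : C5.SmallLevel K₀) (M : SchemeOver ℚ)
  (f f₂ : ShimuraSetGS L Jstar τ K.1.1 → ComplexPoints M)
  (ψ : (Motives.baseChangeHom τ).obj (S.M.obj K) ⟶ (Motives.baseChange ℚ ℂ).obj M)
  (hψ : letI : Algebra L ℂ := τ.toAlgebra
    ∀ P : ComplexPoints (S.M.obj K),
      (AlgPoints.map ψ (AlgPoints.baseChangeEquiv τ (S.M.obj K) P)).left ≫ Motives.baseChangeHomFst (algebraMap ℚ ℂ) M =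
        (f (S.pts K P)).left)
  (t : letI : Algebra L ℂ := τ.toAlgebra; GaloisDescent.bc ℂ (S.M.obj K) ⟶ GaloisDescent.bc ℂ M) (ht : t = ψ.left)

set_option maxHeartbeats 800000 in -- large adelic ∕ Shimura-set terms: instance-heavy statements (as ★ `UnitaryCurveConjugateSliceEqOfTwistedRecip` §1)
include hψ ht in
/-- **The conjugate `σL⁻¹(ψ)` at a Hecke-orbit point IS the point `(f₂[x₀, a], 1)` of `M_ℂ`, given ONE twisted reciprocity law** — ★ p849897 §1
`map_conj_eq_sliceTwo_of_twisted_recip` with the second slice REMOVED: for `σL ∈ Aut(ℂ∕τL)`, the Artin correspondent `s′` of `σL⁻¹` with its twist `d′` at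
`x₀ = [τw]`, ANY `T′` over `(1 × Spec σL) ≫ ψ ≫ (1 × Spec σL|_ℚ⁻¹)`, ANY point map `f₂ : Sh_K(ℂ) → M(ℂ)`, and the twisted law `σL|_ℚ • f[x₀, d′·b] = f₂[x₀, b]`
(all `b`): `T′(pts⁻¹[x₀, aK], 1) = (f₂[x₀, aK], 1)` — the record՚s `recip` at `σL⁻¹` moves the point to `pts⁻¹[x₀, d′aK]`, `ψ` reads `f`, the twisted law lands
on `f₂[x₀, aK]`. [cite: Milne2005ShimuraVarieties, Thm. 13.6 p. 118 L29–39; Def. 12.8 (62) p. 114; Prop. 13.1 p. 117] [cite: Shimura1998, §18.6 (pp. 124–127)] -/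
theorem RecordSystemGS.map_conj_baseChangeEquiv_eq_of_twisted_recip
    (σL : letI : Algebra L ℂ := τ.toAlgebra; ℂ ≃ₐ[L] ℂ)
    {w : Fin 2 → L} (hw : (fun i => τ (w i)) ∈ negCone (Jstar.map τ)) {s' : (FiniteAdeleRing (𝓞 L) L)ˣ}
    (hs' : letI : Algebra L ℂ := τ.toAlgebra; IsArtinCorrespondent L τ s' σL⁻¹.toRingEquiv)
    {d' : ↥(finAdelic (↥(maximalRealSubfield L)) L (IsCMField.complexConj L) 2 Jstar)}
    (hd' : IsDiagTwistGS L Jstar w (recipFactor L s') d')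
    (T' : (Motives.baseChangeHom τ).obj (S.M.obj K) ⟶ (Motives.baseChange ℚ ℂ).obj M)
    (hT' : letI : Algebra L ℂ := τ.toAlgebra
      GaloisDescent.gal ℂ (S.M.obj K) σL⁻¹ ≫ t ≫ GaloisDescent.gal ℂ M (σL.restrictScalars ℚ) = T'.left)
    (htw : letI : Algebra L ℂ := τ.toAlgebra
      ∀ b : ↥(finAdelic (↥(maximalRealSubfield L)) L (IsCMField.complexConj L) 2 Jstar),
        (σL.restrictScalars ℚ) • f (ShimuraSetGS.mk L Jstar τ K.1.1 (fun i => τ (w i)) hw (d' * b)) =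
          f₂ (ShimuraSetGS.mk L Jstar τ K.1.1 (fun i => τ (w i)) hw b))
    (a : ↥(finAdelic (↥(maximalRealSubfield L)) L (IsCMField.complexConj L) 2 Jstar)) :
    letI : Algebra L ℂ := τ.toAlgebra
    AlgPoints.map T' (AlgPoints.baseChangeEquiv τ (S.M.obj K)
        ((S.pts K).symm (ShimuraSetGS.mk L Jstar τ K.1.1 (fun i => τ (w i)) hw a))) =
      AlgPoints.baseChangeEquiv (algebraMap ℚ ℂ) M (f₂ (ShimuraSetGS.mk L Jstar τ K.1.1 (fun i => τ (w i)) hw a)) := by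
  letI iL : Algebra L ℂ := τ.toAlgebra
  have hspec : specAut ℂ σL = specAut ℂ (σL.restrictScalars ℚ) := specAut_restrictScalars_rat' σL
  -- the record's reciprocity at `σL⁻¹`
  have rS : ∀ b, σL⁻¹ • (S.pts K).symm (ShimuraSetGS.mk L Jstar τ K.1.1 (fun i => τ (w i)) hw b) =
      (S.pts K).symm (ShimuraSetGS.mk L Jstar τ K.1.1 (fun i => τ (w i)) hw (d' * b)) :=
    S.recip K σL⁻¹ s' hs' w hw d' hd'
  -- the slice reads `f` on the points `(P, 1)`
  have FT : ∀ b, pullback.lift ((S.pts K).symm (ShimuraSetGS.mk L Jstar τ K.1.1 (fun i => τ (w i)) hw b)).toSpecHom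
        (𝟙 (Spec (.of ℂ))) (toSpecHom_comp_hom_eq (τ := τ) (S.M.obj K) _) ≫ t =
      pullback.lift (f (ShimuraSetGS.mk L Jstar τ K.1.1 (fun i => τ (w i)) hw b)).toSpecHom (𝟙 (Spec (.of ℂ)))
        (toSpecHom_comp_hom_eq (τ := algebraMap ℚ ℂ) M _) := by
    intro b
    have h := S.lift_comp_sliceComplex_left K M f ψ hψ t ht
      ((S.pts K).symm (ShimuraSetGS.mk L Jstar τ K.1.1 (fun i => τ (w i)) hw b))
    rwa [Homeomorph.apply_symm_apply] at h
  set P := (S.pts K).symm (ShimuraSetGS.mk L Jstar τ K.1.1 (fun i => τ (w i)) hw a) with hP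
  apply Over.OverMorphism.ext
  change (AlgPoints.baseChangeEquiv τ (S.M.obj K) P).left ≫ T'.left =
    (AlgPoints.baseChangeEquiv (algebraMap ℚ ℂ) M (f₂ (ShimuraSetGS.mk L Jstar τ K.1.1 (fun i => τ (w i)) hw a))).left
  rw [← lift_eq_baseChangeEquiv_left, ← hT', ← lift_eq_baseChangeEquiv_left (τ := algebraMap ℚ ℂ) M]
  change pullback.lift P.toSpecHom (𝟙 (Spec (.of ℂ))) (toSpecHom_comp_hom_eq (τ := τ) (S.M.obj K) P) ≫
      (GaloisDescent.gal ℂ (S.M.obj K) σL⁻¹ ≫ t ≫ GaloisDescent.gal ℂ M (σL.restrictScalars ℚ)) =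
    pullback.lift (f₂ (ShimuraSetGS.mk L Jstar τ K.1.1 (fun i => τ (w i)) hw a)).toSpecHom (𝟙 (Spec (.of ℂ)))
      (toSpecHom_comp_hom_eq (τ := algebraMap ℚ ℂ) M _)
  have step1 : pullback.lift P.toSpecHom (𝟙 (Spec (.of ℂ))) (toSpecHom_comp_hom_eq (τ := τ) (S.M.obj K) P) ≫
      GaloisDescent.gal ℂ (S.M.obj K) σL⁻¹ =
      specAut ℂ σL ≫ pullback.lift (σL⁻¹ • P).toSpecHom (𝟙 (Spec (.of ℂ)))
        (toSpecHom_comp_hom_eq (τ := τ) (S.M.obj K) (σL⁻¹ • P)) := by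
    have h := lift_comp_gal (τ := τ) (S.M.obj K) σL⁻¹ P
    rwa [inv_inv] at h
  have step3 : ∀ Q : ComplexPoints M,
      pullback.lift Q.toSpecHom (𝟙 (Spec (.of ℂ))) (toSpecHom_comp_hom_eq (τ := algebraMap ℚ ℂ) M Q) ≫
          GaloisDescent.gal ℂ M (σL.restrictScalars ℚ) =
        specAut ℂ (σL.restrictScalars ℚ)⁻¹ ≫ pullback.lift ((σL.restrictScalars ℚ) • Q).toSpecHom (𝟙 (Spec (.of ℂ)))
          (toSpecHom_comp_hom_eq (τ := algebraMap ℚ ℂ) M ((σL.restrictScalars ℚ) • Q)) :=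
    fun Q => lift_comp_gal (τ := algebraMap ℚ ℂ) M (σL.restrictScalars ℚ) Q
  rw [← Category.assoc, step1, Category.assoc, hP, rS a, ← Category.assoc (pullback.lift _ _ _), FT (d' * a),
    step3, htw a, ← Category.assoc, hspec, AbelianVariety.specAut_comp_specAut_symm, Category.id_comp]

/-! ### §2 Everywhere, by the forward law and (β1) piecewise continuity -/

set_option maxHeartbeats 800000 in -- large adelic ∕ Shimura-set terms: instance-heavy statements (as ★ `UnitaryCurveConjugateSliceEqOfTwistedRecip` §2)
include hψ ht in
/-- **THE CONJUGATE SLICE AGAINST A PIECEWISE-CONTINUOUS POINT MAP, EVERYWHERE.**  `M` separated over `ℚ`, `J⋆` `c`-hermitian with unit determinant; for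
`σL ∈ Aut(ℂ∕τL)` with an Artin correspondent `s` and its twist `d` at the special `x₀ = [τw]`, ANY `T′` over `(1 × Spec σL) ≫ ψ ≫ (1 × Spec σL|_ℚ⁻¹)`, a point
map `f₂ : Sh_K(ℂ) → M(ℂ)` CONTINUOUS IN THE CONE VARIABLE on each adelic piece (`hf₂c`, the shape ★ p850443 `continuous_mk_left_of_pts_shadow` produces), and
the FORWARD law `σL|_ℚ • f[x₀, a] = f₂[x₀, d·a]` (all `a`): `T′(P, 1) = (f₂ (pts P), 1)` for EVERY complex point `P` of `M_K` — §1 on the Hecke orbit of `x₀` (the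
twisted law from the forward one by the round trip ★ `twisted_recip_of_forward_recip` at a correspondent `s′` of `σL⁻¹`, which exists), then (β1) ★ p850424
`map_eq_of_heckeOrbit_of_continuous_mk_pts` (Milne Lemma 13.5: the orbit is dense; `T′` continuous as a morphism՚s point map, `P ↦ (f₂ p, 1)` by
★ `AlgPoints.continuous_baseChangeEquiv`; `M_ℂ(ℂ)` Hausdorff). [cite: Milne2005ShimuraVarieties, Lemma 13.5 and Thm. 13.6 p. 118 L29–41; Def. 12.8 (61)–(62) p. 114]
[cite: Shimura1998, §18.6 (pp. 124–127)] [cite: GortzWedhorn2020, Prop. 9.19 and Rem. 9.20] -/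
theorem RecordSystemGS.map_conj_baseChangeEquiv_eq_of_forward_recip_of_continuous [IsSeparated M.hom]
    (hJ : (Jstar.map (IsCMField.complexConj L))ᵀ = Jstar) (hdet : IsUnit Jstar.det)
    (σL : letI : Algebra L ℂ := τ.toAlgebra; ℂ ≃ₐ[L] ℂ)
    {w : Fin 2 → L} (hw : (fun i => τ (w i)) ∈ negCone (Jstar.map τ)) {s : (FiniteAdeleRing (𝓞 L) L)ˣ}
    (hs : letI : Algebra L ℂ := τ.toAlgebra; IsArtinCorrespondent L τ s σL.toRingEquiv)
    {d : ↥(finAdelic (↥(maximalRealSubfield L)) L (IsCMField.complexConj L) 2 Jstar)}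
    (hd : IsDiagTwistGS L Jstar w (recipFactor L s) d)
    (T' : (Motives.baseChangeHom τ).obj (S.M.obj K) ⟶ (Motives.baseChange ℚ ℂ).obj M)
    (hT' : letI : Algebra L ℂ := τ.toAlgebra
      GaloisDescent.gal ℂ (S.M.obj K) σL⁻¹ ≫ t ≫ GaloisDescent.gal ℂ M (σL.restrictScalars ℚ) = T'.left)
    (hf₂c : ∀ a : ↥(finAdelic (↥(maximalRealSubfield L)) L (IsCMField.complexConj L) 2 Jstar),
      Continuous fun x : ↥(negCone (Jstar.map τ)) => f₂ (ShimuraSetGS.mk L Jstar τ K.1.1 (x : Fin 2 → ℂ) x.2 a))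
    (hfw : letI : Algebra L ℂ := τ.toAlgebra
      ∀ a : ↥(finAdelic (↥(maximalRealSubfield L)) L (IsCMField.complexConj L) 2 Jstar),
        (σL.restrictScalars ℚ) • f (ShimuraSetGS.mk L Jstar τ K.1.1 (fun i => τ (w i)) hw a) =
          f₂ (ShimuraSetGS.mk L Jstar τ K.1.1 (fun i => τ (w i)) hw (d * a))) :
    letI : Algebra L ℂ := τ.toAlgebra
    ∀ p : ShimuraSetGS L Jstar τ K.1.1,
      AlgPoints.map T' (AlgPoints.baseChangeEquiv τ (S.M.obj K) ((S.pts K).symm p)) =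
        AlgPoints.baseChangeEquiv (algebraMap ℚ ℂ) M (f₂ p) := by
  letI iL : Algebra L ℂ := τ.toAlgebra
  haveI : IsSeparated ((Motives.baseChange ℚ ℂ).obj M).hom :=
    MorphismProperty.baseChange_obj (P := @IsSeparated) _ M ‹_›
  -- the twisted law at a correspondent `s′` of `σL⁻¹` (which exists), from the forward law
  obtain ⟨s', hs'⟩ := exists_finiteIdele_isArtinCorrespondent_algEquiv L τ σL⁻¹
  obtain ⟨d', hd'⟩ := exists_isDiagTwistGS_recipFactor' L Jstar hJ (hermForm_self_ne_zero_of_embedding_mem_negCone hw) s'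
  have htw := S.twisted_recip_of_forward_recip K M f f₂ σL hw hs hs' hd hd' hfw
  -- the junction homeomorphism `(M_K)_τ(ℂ) ≃ₜ Sh_K(ℂ)` and (β1)
  obtain ⟨e, he⟩ := S.exists_homeomorph_complexFibre K
  exact S.map_eq_of_heckeOrbit_of_continuous_mk_pts K hJ hdet e he T'
    (fun p => AlgPoints.baseChangeEquiv (algebraMap ℚ ℂ) M (f₂ p))
    (fun a => (AlgPoints.continuous_baseChangeEquiv (algebraMap ℚ ℂ) M).comp (hf₂c a)) hw
    fun b => S.map_conj_baseChangeEquiv_eq_of_twisted_recip K M f f₂ ψ hψ t ht σL hw hs' hd' T' hT' htw b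

end OneSlice

/-! ### §3 THE SHEET HEAD over the slice field: `ℓ_{τE∘γ} Q ≫ ε ≫ pr₁ = f₂ (pts Q)` -/

section Sheet

variable (S : RecordSystemGS L Jstar τ K₀) (K : C5.SmallLevel K₀) (M : SchemeOver ℚ)
  {E : Type} [Field E] [NumberField E] [Algebra L E] (τE : E →+* ℂ) (hτ : τE.comp (algebraMap L E) = τ)

set_option maxHeartbeats 800000 in -- instance-heavy slice readings + complexification bookkeeping (as ★ `UnitaryCurveConjugateSliceDescends` §2)
include hτ in
/-- **THE POINT LAW ON THE CONJUGATE SHEET.**  For the curve record system `S` over `L` along `τ`, `J⋆` hermitian with unit determinant, a small level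
`K`, a `ℚ`-scheme `M` separated over `ℚ`, a number field `E ⊇ L` with `τE ∘ (L → E) = τ`, the sheet `eE : E →ₐ[L] ℂ` of `τE` (`eE x = τE x`), an
`E`-slice `ε : M_K ⊗_L E → M ⊗_ℚ E` reading `f : Sh_K(ℂ) → M(ℂ)` on complex points (E5 currency `hε`), `γ ∈ Aut_L(E)` with a lift `σL ∈ Aut(ℂ∕τL)`
(`σL ∘ τE = τE ∘ γ`), an Artin correspondent `s ↔ σL` with twist `d` at the special `x₀ = [τw]`, a point map `f₂ : Sh_K(ℂ) → M(ℂ)` continuous in the cone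
variable on each adelic piece, and the FORWARD law `σL|_ℚ • f[x₀, a] = f₂[x₀, d·a]` (all `a`):
**`ℓ_{τE∘γ} Q ≫ ε ≫ pr₁ = f₂ (pts Q)` for EVERY complex point `Q` of `M_K`** (`ℓ_{τE∘γ} Q = (Q, Spec(τE ∘ γ))` the section of the thickening
`M_K ⊗_L E` on the conjugate sheet, ★ `thickeningLift`).  PROOF: `Spec σL⁻¹ ≫ ℓ_{τE∘γ} Q = ℓ_{τE}(σL⁻¹ • Q)` (§0) is a `τE`-point over `σL⁻¹ • Q`, so
`hε` gives `ℓ_{τE∘γ} Q ≫ ε ≫ pr₁ = Spec σL ≫ f(pts(σL⁻¹ • Q))`; the conjugate `T′ = (1 × Spec σL) ≫ ψ ≫ (1 × Spec σL|_ℚ⁻¹)` of the complexified slice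
`ψ = ε ⊗_{τE} ℂ` (★ p850264 §1: `ψ` reads `f`) has the SAME first projection at `(Q, 1)` (★ `lift_comp_gal`), and §2 evaluates it as `(f₂ (pts Q), 1)`.
[cite: Milne2005ShimuraVarieties, Thm. 13.6 p. 118 and Prop. 13.1 p. 117; Lemma 13.5] [cite: GortzWedhorn2020, §(4.8)–(4.9), Prop. 4.16, §(14.20)]
[cite: Shimura1998, §18.6 (pp. 124–128)] [cite: RapoportSmithlingZhang2020Diagonal, §3.2 p. 11] -/
theorem RecordSystemGS.thickeningLift_comp_slice_fst_eq_of_forward_recip_of_continuous [IsSeparated M.hom]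
    (hJ : (Jstar.map (IsCMField.complexConj L))ᵀ = Jstar) (hdet : IsUnit Jstar.det)
    (f f₂ : ShimuraSetGS L Jstar τ K.1.1 → ComplexPoints M)
    (ε : (Motives.baseChange L E).obj (S.M.obj K) ⟶ (Motives.baseChange ℚ E).obj M)
    (hε : letI : Algebra E ℂ := τE.toAlgebra
      ∀ (P : ComplexPoints ((Motives.baseChange L E).obj (S.M.obj K)))
        (Pflat : letI : Algebra L ℂ := τ.toAlgebra; ComplexPoints (S.M.obj K)),
        Pflat.left = P.left ≫ pullback.fst (S.M.obj K).hom (bcSpec L E) →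
        (AlgPoints.map ε P).left ≫ pullback.fst M.hom (bcSpec ℚ E) =
          (letI : Algebra L ℂ := τ.toAlgebra; (f (S.pts K Pflat)).left))
    (eE : letI : Algebra L ℂ := τ.toAlgebra; E →ₐ[L] ℂ) (heE : ∀ x : E, eE x = τE x)
    (γ : E ≃ₐ[L] E) (σL : letI : Algebra L ℂ := τ.toAlgebra; ℂ ≃ₐ[L] ℂ) (hσγ : ∀ x : E, σL (τE x) = τE (γ x))
    {w : Fin 2 → L} (hw : (fun i => τ (w i)) ∈ negCone (Jstar.map τ)) {s : (FiniteAdeleRing (𝓞 L) L)ˣ}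
    (hs : letI : Algebra L ℂ := τ.toAlgebra; IsArtinCorrespondent L τ s σL.toRingEquiv)
    {d : ↥(finAdelic (↥(maximalRealSubfield L)) L (IsCMField.complexConj L) 2 Jstar)}
    (hd : IsDiagTwistGS L Jstar w (recipFactor L s) d)
    (hf₂c : ∀ a : ↥(finAdelic (↥(maximalRealSubfield L)) L (IsCMField.complexConj L) 2 Jstar),
      Continuous fun x : ↥(negCone (Jstar.map τ)) => f₂ (ShimuraSetGS.mk L Jstar τ K.1.1 (x : Fin 2 → ℂ) x.2 a))
    (hfw : letI : Algebra L ℂ := τ.toAlgebra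
      ∀ a : ↥(finAdelic (↥(maximalRealSubfield L)) L (IsCMField.complexConj L) 2 Jstar),
        (σL.restrictScalars ℚ) • f (ShimuraSetGS.mk L Jstar τ K.1.1 (fun i => τ (w i)) hw a) =
          f₂ (ShimuraSetGS.mk L Jstar τ K.1.1 (fun i => τ (w i)) hw (d * a))) :
    letI : Algebra L ℂ := τ.toAlgebra
    ∀ Q : ComplexPoints (S.M.obj K),
      (thickeningLift (eE.comp (γ : E →ₐ[L] E)) (S.M.obj K) Q).left ≫ ε.left ≫ pullback.fst M.hom (bcSpec ℚ E) =
        (f₂ (S.pts K Q)).left := by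
  letI iE : Algebra E ℂ := τE.toAlgebra; letI iL : Algebra L ℂ := τ.toAlgebra
  have hspec : specAut ℂ σL = specAut ℂ (σL.restrictScalars ℚ) := specAut_restrictScalars_rat' σL
  have hσe : ∀ x : E, σL (eE x) = eE (γ x) := fun x => by rw [heE, heE, hσγ]
  -- (A) the left-hand side through `hε` at the `τE`-point `ℓ_{τE} (σL⁻¹ • Q)`
  have hA : ∀ Q : ComplexPoints (S.M.obj K),
      (thickeningLift (eE.comp (γ : E →ₐ[L] E)) (S.M.obj K) Q).left ≫ ε.left ≫ pullback.fst M.hom (bcSpec ℚ E) =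
        specAut ℂ σL ≫ (f (S.pts K (σL⁻¹ • Q))).toSpecHom := by
    intro Q
    have hhom : (thickeningLift eE (S.M.obj K) (σL⁻¹ • Q)).left ≫ ((Motives.baseChange L E).obj (S.M.obj K)).hom =
        Spec.map (CommRingCat.ofHom (algebraMap E ℂ)) := by
      change (thickeningLift eE (S.M.obj K) (σL⁻¹ • Q)).left ≫ pullback.snd (S.M.obj K).hom (bcSpec L E) = _
      rw [thickeningLift_left_comp_snd]
      congr 2
      ext x
      exact heE x
    let P : ComplexPoints ((Motives.baseChange L E).obj (S.M.obj K)) :=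
      Over.homMk (thickeningLift eE (S.M.obj K) (σL⁻¹ • Q)).left hhom
    have hP : (σL⁻¹ • Q).left = P.left ≫ pullback.fst (S.M.obj K).hom (bcSpec L E) := by
      change (σL⁻¹ • Q).left = (thickeningLift eE (S.M.obj K) (σL⁻¹ • Q)).left ≫ pullback.fst (S.M.obj K).hom (bcSpec L E)
      rw [thickeningLift_left_comp_fst]
    have h0 := hε P (σL⁻¹ • Q) hP
    erw [AlgPoints.map_apply, Over.comp_left, Category.assoc] at h0
    change (thickeningLift eE (S.M.obj K) (σL⁻¹ • Q)).toSpecHom ≫ ε.left ≫ pullback.fst M.hom (bcSpec ℚ E) =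
      (f (S.pts K (σL⁻¹ • Q))).toSpecHom at h0
    change (thickeningLift (eE.comp (γ : E →ₐ[L] E)) (S.M.obj K) Q).toSpecHom ≫ ε.left ≫ pullback.fst M.hom (bcSpec ℚ E) = _
    rw [thickeningLift_left_comp_eq_specAut_comp (τ := τ) (S.M.obj K) eE γ σL hσe Q, Category.assoc, h0]
  -- (B) the complexified slice `ψ := gX⁻¹ ≫ ε_ℂ ≫ gM` reads `f` (★ p850264 §1, bookkeeping as in its §2)
  obtain ⟨gX, hgX1, hgX2, -⟩ := Motives.exists_iso_baseChangeHom_baseChange hτ (S.M.obj K)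
  have hτℚ : τE.comp (algebraMap ℚ E) = algebraMap ℚ ℂ := Subsingleton.elim _ _
  obtain ⟨gM, hgM1, -, -⟩ := Motives.exists_iso_baseChangeHom_baseChange (τ := algebraMap ℚ ℂ) hτℚ M
  obtain ⟨tX, htX⟩ : ∃ tX : GaloisDescent.bc ℂ ((Motives.baseChange L E).obj (S.M.obj K)) ⟶ GaloisDescent.bc ℂ (S.M.obj K),
      tX = gX.hom.left := ⟨_, rfl⟩
  obtain ⟨u, hu⟩ : ∃ u : GaloisDescent.bc ℂ (S.M.obj K) ⟶ GaloisDescent.bc ℂ ((Motives.baseChange L E).obj (S.M.obj K)),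
      u = gX.inv.left := ⟨_, rfl⟩
  obtain ⟨tM, htM⟩ : ∃ tM : GaloisDescent.bc ℂ ((Motives.baseChange ℚ E).obj M) ⟶ GaloisDescent.bc ℂ M, tM = gM.hom.left := ⟨_, rfl⟩
  obtain ⟨tε, htε⟩ : ∃ tε : GaloisDescent.bc ℂ ((Motives.baseChange L E).obj (S.M.obj K)) ⟶ GaloisDescent.bc ℂ ((Motives.baseChange ℚ E).obj M),
      tε = ((bcFunctor E ℂ).map ε).left := ⟨_, rfl⟩
  have huX : u ≫ tX = 𝟙 _ := by rw [htX, hu]; exact congrArg CommaMorphism.left gX.inv_hom_id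
  have hgX1' : tX ≫ pullback.fst (S.M.obj K).hom (bcSpec L ℂ) =
      pullback.fst ((Motives.baseChange L E).obj (S.M.obj K)).hom (bcSpec E ℂ) ≫ pullback.fst (S.M.obj K).hom (bcSpec L E) := by
    rw [htX]; exact hgX1
  have hgX2' : tX ≫ pullback.snd (S.M.obj K).hom (bcSpec L ℂ) = pullback.snd ((Motives.baseChange L E).obj (S.M.obj K)).hom (bcSpec E ℂ) := by
    rw [htX]; exact hgX2
  have hgM1' : tM ≫ pullback.fst M.hom (bcSpec ℚ ℂ) =
      pullback.fst ((Motives.baseChange ℚ E).obj M).hom (bcSpec E ℂ) ≫ pullback.fst M.hom (bcSpec ℚ E) := by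
    rw [htM]; exact hgM1
  have hu1 : u ≫ pullback.fst ((Motives.baseChange L E).obj (S.M.obj K)).hom (bcSpec E ℂ) ≫ pullback.fst (S.M.obj K).hom (bcSpec L E) =
      pullback.fst (S.M.obj K).hom (bcSpec L ℂ) := by
    rw [← hgX1', ← Category.assoc, huX, Category.id_comp]
  have hu2 : u ≫ pullback.snd ((Motives.baseChange L E).obj (S.M.obj K)).hom (bcSpec E ℂ) = pullback.snd (S.M.obj K).hom (bcSpec L ℂ) := by
    rw [← hgX2', ← Category.assoc, huX, Category.id_comp]
  let ψ : (Motives.baseChangeHom τ).obj (S.M.obj K) ⟶ (Motives.baseChange ℚ ℂ).obj M := gX.inv ≫ (bcFunctor E ℂ).map ε ≫ gM.hom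
  obtain ⟨t, ht⟩ : ∃ t : GaloisDescent.bc ℂ (S.M.obj K) ⟶ GaloisDescent.bc ℂ M, t = ψ.left := ⟨_, rfl⟩
  have htdef : t = u ≫ tε ≫ tM := by rw [ht, hu, htε, htM]; rfl
  have hreadf : ∀ P : ComplexPoints (S.M.obj K),
      pullback.lift P.toSpecHom (𝟙 (Spec (.of ℂ))) (toSpecHom_comp_hom_eq (τ := τ) (S.M.obj K) P) ≫ t ≫
          pullback.fst M.hom (bcSpec ℚ ℂ) = (f (S.pts K P)).toSpecHom := by
    intro P
    have h1 := S.lift_comp_sliceComplexOfSlice_fst K M τE f ε hε tε htε u hu1 hu2 tM hgM1' P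
    rw [htdef]
    erw [Category.assoc] at h1 ⊢
    exact h1
  have hψ : ∀ P : ComplexPoints (S.M.obj K),
      (AlgPoints.map ψ (AlgPoints.baseChangeEquiv τ (S.M.obj K) P)).left ≫ Motives.baseChangeHomFst (algebraMap ℚ ℂ) M =
        (f (S.pts K P)).left := by
    intro P
    rw [AlgPoints.map_apply, Over.comp_left, ← lift_eq_baseChangeEquiv_left, ← ht]
    exact hreadf P
  -- (C) the conjugate `T′ := (1 × Spec σL) ≫ ψ ≫ (1 × Spec σL|_ℚ⁻¹)` is a morphism OVER `ℂ`
  have hTsnd : t ≫ pullback.snd M.hom (bcSpec ℚ ℂ) = pullback.snd (S.M.obj K).hom (bcSpec L ℂ) := by rw [ht]; exact Over.w ψ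
  have hw' : (GaloisDescent.gal ℂ (S.M.obj K) σL⁻¹ ≫ t ≫ GaloisDescent.gal ℂ M (σL.restrictScalars ℚ)) ≫
      pullback.snd M.hom (bcSpec ℚ ℂ) = pullback.snd (S.M.obj K).hom (bcSpec L ℂ) := by
    rw [Category.assoc, Category.assoc, GaloisDescent.gal_snd, ← Category.assoc t, hTsnd,
      GaloisDescent.gal_snd_assoc, inv_inv, hspec, AbelianVariety.specAut_comp_specAut_symm, Category.comp_id]
  let T' : (Motives.baseChangeHom τ).obj (S.M.obj K) ⟶ (Motives.baseChange ℚ ℂ).obj M :=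
    Over.homMk (GaloisDescent.gal ℂ (S.M.obj K) σL⁻¹ ≫ t ≫ GaloisDescent.gal ℂ M (σL.restrictScalars ℚ)) hw'
  -- (D) its first projection at `(Q, 1)` is the left-hand side of (A)
  have hD : ∀ Q : ComplexPoints (S.M.obj K),
      (AlgPoints.map T' (AlgPoints.baseChangeEquiv τ (S.M.obj K) Q)).left ≫ pullback.fst M.hom (bcSpec ℚ ℂ) =
        specAut ℂ σL ≫ (f (S.pts K (σL⁻¹ • Q))).toSpecHom := by
    intro Q
    rw [AlgPoints.map_apply, Over.comp_left, ← lift_eq_baseChangeEquiv_left]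
    change (pullback.lift Q.toSpecHom (𝟙 (Spec (.of ℂ))) (toSpecHom_comp_hom_eq (τ := τ) (S.M.obj K) Q) ≫
      (GaloisDescent.gal ℂ (S.M.obj K) σL⁻¹ ≫ t ≫ GaloisDescent.gal ℂ M (σL.restrictScalars ℚ))) ≫ pullback.fst M.hom (bcSpec ℚ ℂ) = _
    have step1 : pullback.lift Q.toSpecHom (𝟙 (Spec (.of ℂ))) (toSpecHom_comp_hom_eq (τ := τ) (S.M.obj K) Q) ≫
        GaloisDescent.gal ℂ (S.M.obj K) σL⁻¹ =
        specAut ℂ σL ≫ pullback.lift (σL⁻¹ • Q).toSpecHom (𝟙 (Spec (.of ℂ)))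
          (toSpecHom_comp_hom_eq (τ := τ) (S.M.obj K) (σL⁻¹ • Q)) := by
      have h := lift_comp_gal (τ := τ) (S.M.obj K) σL⁻¹ Q
      rwa [inv_inv] at h
    rw [← Category.assoc (pullback.lift _ _ _), step1, Category.assoc, Category.assoc, Category.assoc, GaloisDescent.gal_fst,
      hreadf (σL⁻¹ • Q)]
  -- (E) §2 evaluates `T′(Q, 1) = (f₂ (pts Q), 1)`; read its first projection
  have hall := S.map_conj_baseChangeEquiv_eq_of_forward_recip_of_continuous K M f f₂ ψ hψ t ht hJ hdet σL hw hs hd T' rfl hf₂c hfw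
  intro Q
  have hQ := hall (S.pts K Q)
  rw [Homeomorph.symm_apply_apply] at hQ
  have hQ' := congrArg (fun R : ComplexPoints ((Motives.baseChange ℚ ℂ).obj M) => R.left ≫ pullback.fst M.hom (bcSpec ℚ ℂ)) hQ
  exact (hA Q).trans ((hD Q).symm.trans (hQ'.trans (AlgPoints.baseChangeEquiv_apply_left_comp_fst (algebraMap ℚ ℂ) M _)))

end Sheet

end Literature.AlgebraicGeometry.ShimuraVarieties.UnitaryCanonicalModel

end
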